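import Mathlib
import Summits.QuantumFields.YangMills.Theses.CentreWallReflection
import HarnessLib

/-!
# Route `CentreWallReflection` (planner ym-idea-4 g18, LINE g18-A), item ⟨stmt-QuantumFields-23709⟩ `Assembly` — CLOSED

`assembly_proof : Summit.QuantumFields.YangMills.Theses.CentreWallReflection.Assembly`, i.e.
`WallReflection → NegligibleWalls → SubexponentialFloor → MarginalTwistOnset.FixedTorusCriterionFailure`.
Pure logic and linear arithmetic (the planner's glue, HOME `bc/g18-A/GlueCheck.lean`, re-typed against the tree's route file): given
`S = L + 1 ≥ 2` and `ε₀ < 1`, take the central `z` and, for the plane `q₀ = (0,1)` and accuracy `ε²` with `ε = min((1−ε₀)/32, 1)`, an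
admissible wall datum from `NegligibleWalls`; `WallReflection` gives `s₀` and the conditional bound `Z(z) ≤ 16εZ(1)`; `SubexponentialFloor`
supplies the pinned-plaquette smallness eventually in `β`; hence eventually `Z(z)/Z(1) ≤ 16ε < 1 − ε₀`.
HONEST FRAMING: the two cruxes (`NegligibleWalls`, `WallReflection`) and the support `SubexponentialFloor` are OPEN; this is the S-sized
assembly only; no summit statement and no mass gap is proved.  No `sorry`, no new axiom, no new definition.
References: [cite: Luscher1983, §2]; [cite: tHooft1979Flux, §2 (2.2)].
-/

set_option autoImplicit false

noncomputable section

open MeasureTheory Filter Topology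

namespace Summit.QuantumFields.YangMills.Theorems.CentreWallReflection

/-- ★★★ **`CentreWallReflection.Assembly`** ⟨stmt-QuantumFields-23709⟩: `WallReflection → NegligibleWalls → SubexponentialFloor →
FixedTorusCriterionFailure`. [cite: Luscher1983, §2] [cite: tHooft1979Flux, §2 (2.2)] -/
theorem assembly_proof : Summit.QuantumFields.YangMills.Theses.CentreWallReflection.Assembly := by
  intro hW hN hF G _ _ _ _ hG hZc r Z hZ S hS2 ε₀ hε₀
  obtain ⟨L, rfl⟩ : ∃ L, S = L + 1 := ⟨S - 1, by omega⟩
  have hL : 1 ≤ L := by omega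
  -- the central element and, for the plane q₀ and accuracy ε², an admissible wall datum
  obtain ⟨z, hz, hdat⟩ := hN G hG hZc r Z hZ L hL
  let q₀ : {p : Fin 4 × Fin 4 // p.1 < p.2} := ⟨((0 : Fin 4), (1 : Fin 4)), by decide⟩
  obtain ⟨ε, hεdef⟩ : ∃ ε : ℝ, ε = min ((1 - ε₀) / 32) 1 := ⟨_, rfl⟩
  have hε : 0 < ε := by rw [hεdef]; exact lt_min (by linarith) one_pos
  have hε1 : ε ≤ 1 := by rw [hεdef]; exact min_le_right _ _
  have hεle : ε ≤ (1 - ε₀) / 32 := by rw [hεdef]; exact min_le_left _ _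
  have hε2 : 0 < ε ^ 2 := by positivity
  obtain ⟨O, W, δ, hOm, hWm, hOc, hWc, hsep, hδ, hloc, hwall⟩ := hdat q₀ (ε ^ 2) hε2
  obtain ⟨s₀, hs₀, hrefl⟩ :=
    hW G hG r Z hZ L hL z hz q₀ O W δ ε hOm hWm hOc hWc hsep hδ hloc hε hε1
  have hfloor := hF G hG r Z hZ L hL q₀ s₀ (ε ^ 2) hs₀ hε2
  filter_upwards [hwall, hfloor, eventually_ge_atTop (0 : ℝ)] with β hwβ hfβ hβ0
  refine ⟨z, hz, q₀, ?_⟩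
  have htw : Z β (L + 1) z q₀ ≤ 16 * ε * Z β (L + 1) 1 q₀ := hrefl β hβ0 hwβ hfβ
  have hpos : 0 < Z β (L + 1) 1 q₀ := by
    have h1 : 0 < (((L + 1 : ℕ) : ℝ) ^ 2) * Real.exp (-(s₀ * β)) := by positivity
    exact pos_of_mul_pos_right (lt_of_lt_of_le h1 hfβ) hε2.le
  have hratio : Z β (L + 1) z q₀ / Z β (L + 1) 1 q₀ ≤ 16 * ε := by
    rw [div_le_iff₀ hpos]; exact htw
  have h8 : 16 * ε < 1 - ε₀ := by linarith
  linarith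

end Summit.QuantumFields.YangMills.Theorems.CentreWallReflection

end
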